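import Summits.BirchSwinnertonDyer.BirchSwinnertonDyer.Theses.TameQuarticManinParity
import HarnessLib

/-!
# Route `TameQuarticManinParity`: E30 `PrymDefectHeckeEisensteinSplit` (stmt-BirchSwinnertonDyer-23597)
# ⟸ E32a `PrymLatticeFixedPointSpan` (stmt-23756) ∧ E32b `FixedPointSymbolHeckeShift` (stmt-23757), BY NAME

Lead seat `cruxlead-stmt-BirchSwinnertonDyer-23367` (crux MS, line `abelian-fixed-points`), landing the pen's LINE 32
glue (bsd-idea-3 g9, `LINE32_E30_of.lean`, critic VERDICT #193 PASS) verbatim up to namespace. E32a: the Hilbert-90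
defect `Λ_P/(t−1)Λ` is spanned by the FIXED-POINT SYMBOLS `{∞, γ∞}`, `|3(a+d) − c| ≤ 6`; E32b: `(T_p − 2)·{∞, γ∞} ∈ (t−1)Λ`
for those `γ` and primes `p ≡ 1 (mod N)`. The glue is `Submodule.mem_sup` + `span_induction` + `T_p Λ₁ ⊆ Λ₁`
(`T_smul_mem_shiftSubOneLattice`). THEOREMS ONLY; no definition, no named fact, no `sorry`. No summit is proved;
BSD is NOT proved.
-/

set_option autoImplicit false
-- D-0017: single-problem summit, so `Summit.BirchSwinnertonDyer.BirchSwinnertonDyer.…` repeats a namespace BY DESIGN.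
set_option linter.dupNamespace false

noncomputable section

namespace Summit.BirchSwinnertonDyer.BirchSwinnertonDyer.Theorems.TameQuarticManinParity

open Summit.BirchSwinnertonDyer.BirchSwinnertonDyer.Theses.TameQuarticManinParity
open Literature.NumberTheory.EllipticCurves Literature.NumberTheory.EllipticCurves.ModularForms CongruenceSubgroup
  Literature.NumberTheory.ModularSymbols

/-- `(T − 2) • y = T • y − 2 • y` with the natural-number scalar on the right (plumbing). [folklore] -/
private theorem ring_sub_two_smul {A M : Type*} [Ring A] [AddCommGroup M] [Module A M] (T : A) (y : M) :
    (T - (2 : A)) • y = T • y - (2 : ℕ) • y := by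
  rw [sub_smul, show (2 : A) • y = (2 : ℕ) • y by rw [← Nat.cast_smul_eq_nsmul A (2 : ℕ) y, Nat.cast_ofNat]]

/-- `r • (span S) ⊆ Q` as soon as `r • S ⊆ Q`, for a `ℤ`-submodule `Q` of an `A`-module (plumbing). [folklore] -/
private theorem smul_mem_of_span {A M : Type*} [Ring A] [AddCommGroup M] [Module A M] (r : A) (S : Set M)
    (Q : Submodule ℤ M) (hS : ∀ s ∈ S, r • s ∈ Q) {y : M} (hy : y ∈ Submodule.span ℤ S) : r • y ∈ Q := by
  induction hy using Submodule.span_induction with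
  | mem s hs => exact hS s hs
  | zero => rw [smul_zero]; exact Q.zero_mem
  | add a b _ _ ha hb => rw [smul_add]; exact Q.add_mem ha hb
  | smul n a _ ha => rw [smul_comm]; exact Q.smul_mem n ha

/-- **`(T_p − 2)Λ₁ ⊆ Λ₁`** (`9 ∣ N`, `p ≠ 3` prime): the shift-minus-one lattice `Λ₁ = (t − 1)Λ` is `T_p`-stable
(`T_smul_mem_shiftSubOneLattice`: `T_p t = t^{±1} T_p`). [cite: Harrison2011X0108, §2] -/
theorem T_sub_two_smul_mem_shiftSubOneLattice (N : ℕ) [NeZero N] (h9 : 3 ^ 2 ∣ N) {p : ℕ} (hp : p.Prime)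
    (hp3 : p ≠ 3) {x : periodHomologyHecke N} (hx : x ∈ shiftSubOneLattice N h9) :
    (HeckeRing0.T N 2 p hp - (2 : HeckeRing0 N 2)) • x ∈ shiftSubOneLattice N h9 := by
  have e := ring_sub_two_smul (HeckeRing0.T N 2 p hp) x
  rw [e]
  exact (shiftSubOneLattice N h9).sub_mem (T_smul_mem_shiftSubOneLattice h9 hp hp3 hx)
    ((shiftSubOneLattice N h9).smul_of_tower_mem 2 hx)

set_option maxHeartbeats 1000000 in
-- the route statements unfold to large binder telescopes; elaborating the three by-name decls needs the head-room
/-- **E30 ⟸ E32a ∧ E32b** (stmt-23597 ⟸ stmt-23756 ∧ stmt-23757, all three by their route-decl names): for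
`y ∈ Λ_P`, write `y = y₁ + y₂` with `y₁ ∈ Λ₁` and `y₂` in the span of the fixed-point symbols (E32a); then
`(T_p − 2)y₁ ∈ Λ₁` (`T_p`-stability) and `(T_p − 2)y₂ ∈ Λ₁` symbol by symbol (E32b). [folklore] -/
theorem heckeEisensteinSplit_of (hA : PrymLatticeFixedPointSpan) (hB : FixedPointSymbolHeckeShift) :
    PrymDefectHeckeEisensteinSplit := by
  intro N _ h9 p hp hp3 hp1 y hy
  obtain ⟨y₁, hy₁, y₂, hy₂, rfl⟩ := Submodule.mem_sup.mp (hA N h9 hy)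
  rw [smul_add]
  refine (shiftSubOneLattice N h9).add_mem (T_sub_two_smul_mem_shiftSubOneLattice N h9 hp hp3 hy₁) ?_
  refine smul_mem_of_span (HeckeRing0.T N 2 p hp - (2 : HeckeRing0 N 2)) _ (shiftSubOneLattice N h9) ?_ hy₂
  rintro s ⟨γ, hγ, rfl⟩
  exact hB N h9 p hp hp3 hp1 γ hγ

end Summit.BirchSwinnertonDyer.BirchSwinnertonDyer.Theorems.TameQuarticManinParity

end
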